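import Summits.NavierStokesRegularity.NavierStokesRegularity.Theorems.StrainDoorsVelocityRecord
import Summits.NavierStokesRegularity.NavierStokesRegularity.Theorems.StrainDoorsDSSRecords
import Literature.Analysis.FluidPDE.ChaeWolfRemovingDSS
import HarnessLib

/-!
# StrainDoorsDSSVelocityRecord — THE VELOCITY RECORD OF A DSS SINGULARITY («2Π* ≥ V*» on Chae–Wolf's class)

nsreg-p1 g35, ROUND-54 PART B (helper lane of `stmt-NavierStokesRegularity-0056`, rung N0; lands after PART A
`StrainDoorsVelocityRecord` and ROUND-53 PART 2 `StrainDoorsDSSRecords`).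

For a `c`-discretely self-similar field (`IsDiscretelySelfSimilar c u`, `c > 1`, singular time `0`) the squared
velocity number `(0 − t)·|u(t,x)|²` is DSS-invariant (§1), so its supremum over ALL of `(−∞,0) × ℝ³` is a supremum
over one period `t ∈ [−c², −1]`; if `u → 0` at spatial infinity uniformly on the period — which is exactly what a
Type-I bound `|u| ≤ C/(|x| + √(−t))` gives (`periodVelocityDecay_of_typeI`), and such a bound is the CONCLUSION of
Chae–Wolf's Theorem 1.1 for DSS solutions in `C((−∞,0); L^q)`, `q ≥ 3` (tree fact `chaeWolf2017_dss_typeI_decay`) —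
then the supremum is ATTAINED (§2 `dss_velocityNumber_attained`) unless `u ≡ 0`, and the attained point is a running
record with an open past, so PART A's velocity record law holds there with NO record hypothesis:

* §3 ★★ `dss_velocity_record_law` — smooth decaying DSS solution, `u ≢ 0`: there is `(t,x)`, `t < 0`, `u(t,x) ≠ 0`,
  maximising the velocity number over all of `(−∞,0) × ℝ³`, at which
  `|u|·(1 + 2ν(0 − t)|∇û|²_F) ≤ 2(0 − t)·(−⟪û, ∇p⟫)` and hence `|u(t,x)| ≤ 2(0 − t)·|∇p(t,x)|`
  (`dss_velocity_le_pressureGradient`): **in scale-invariant numbers, `V* ≤ 2Π*`** — the top speed number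
  `V* = max (−t)^{1/2}|u|` of a DSS singularity is at most twice its pressure-gradient number `(−t)^{3/2}|∇p|` read
  at the fastest point.
* §4 ★★ `chaeWolf_dss_velocity_record_law` — THE FIRST RECORD LAW ON A NAMED-FACT CLASS WITH NO EXTRA HYPOTHESIS:
  under the Literature fact `chaeWolf2017_dss_typeI_decay` (Chae–Wolf 2017, Thm 1.1), every `c`-DSS classical
  solution (`ν = 1`) with slices continuous into `L^q`, `q ≥ 3`, and `u ≢ 0` has such a point.  (Chae–Wolf's Thm 1.3,
  tree fact `chaeWolf2017_removing_dss`, removes these solutions only for `c` close to `1`; the law constrains them for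
  EVERY `c > 1`.)

WHAT THIS IS NOT: `TypeIDSSLiouville` (the DSS Liouville problem for general `c > 1`) stays OPEN; no profile is
excluded; `0056`/NS regularity are not proved.  No new definitions; no sorry.
[cite: ChaeWolf2017RemovingDSS, Theorem 1.1 (arXiv:1610.09464 p. 3, (1.5)); Tsai2014, §1; BradshawTsai2017, §5]
-/

noncomputable section

open MeasureTheory Set Function Filter Metric Real InnerProductSpace
open _root_.Topology
open scoped ENNReal NNReal RealInnerProductSpace ContDiff Laplacian
open Literature.Analysis Literature.Analysis.FluidPDE
open Literature.Analysis.FluidPDE.VorticityDirectionDynamics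

set_option linter.dupNamespace false

namespace Summit.NavierStokesRegularity.NavierStokesRegularity.Theorems.StrainDoors

open Summit.NavierStokesRegularity.NavierStokesRegularity.Theorems.ArgmaxDoors

set_option maxSynthPendingDepth 3

/-! ## §1 DSS invariance of the velocity number; velocity decay from a Type-I bound -/

/-- **DSS scaling of the velocity**: `u(t,x) = c·u(c²t, cx)`. [cite: Tsai2014, §1] -/
theorem dss_velocity_eq {c : ℝ} {u : ℝ → (EuclideanSpace ℝ (Fin 3)) → (EuclideanSpace ℝ (Fin 3))}
    (h : IsDiscretelySelfSimilar c u) (t : ℝ) (x : EuclideanSpace ℝ (Fin 3)) :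
    u t x = c • u (c ^ 2 * t) (c • x) := by
  have key : u t = fun y => c • u (c ^ 2 * t) (c • y) := (congrFun h t).symm
  exact congrFun key x

/-- **The squared velocity number is DSS-invariant**: `(0 − t)|u(t,x)|² = (0 − c²t)|u(c²t, cx)|²`. [folklore] -/
theorem dss_velocityNumber_eq {c : ℝ} {u : ℝ → (EuclideanSpace ℝ (Fin 3)) → (EuclideanSpace ℝ (Fin 3))}
    (h : IsDiscretelySelfSimilar c u) (t : ℝ) (x : EuclideanSpace ℝ (Fin 3)) :
    (0 - t) * ‖u t x‖ ^ 2 = (0 - c ^ 2 * t) * ‖u (c ^ 2 * t) (c • x)‖ ^ 2 := by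
  rw [dss_velocity_eq h t x, norm_smul, Real.norm_eq_abs, mul_pow, sq_abs]
  ring

/-- Period transport of the squared velocity number along the powers of the scaling factor. [folklore] -/
theorem dss_velocityNumber_zpow {c : ℝ} (hc : c ≠ 0)
    {u : ℝ → (EuclideanSpace ℝ (Fin 3)) → (EuclideanSpace ℝ (Fin 3))}
    (h : IsDiscretelySelfSimilar c u) (n : ℤ) (t : ℝ) (x : EuclideanSpace ℝ (Fin 3)) :
    (0 - t) * ‖u t x‖ ^ 2 = (0 - (c ^ n) ^ 2 * t) * ‖u ((c ^ n) ^ 2 * t) ((c ^ n) • x)‖ ^ 2 :=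
  dss_velocityNumber_eq (h.zpow hc n) t x

/-- **Velocity decay on the period from a Type-I bound.**  `|u(t,x)| ≤ C/(|x| + √(−t))` for `t < 0`
(`HasTypeIDecay C u`) implies `u → 0` at spatial infinity uniformly on the period `t ∈ [−c², −1]`. [folklore] -/
theorem periodVelocityDecay_of_typeI {c C : ℝ}
    {u : ℝ → (EuclideanSpace ℝ (Fin 3)) → (EuclideanSpace ℝ (Fin 3))} (hI : HasTypeIDecay C u) :
    ∀ ε : ℝ, 0 < ε → ∃ R : ℝ, ∀ t ∈ Icc (-(c ^ 2)) (-1), ∀ x : EuclideanSpace ℝ (Fin 3),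
      R ≤ ‖x‖ → ‖u t x‖ ≤ ε := by
  intro ε hε
  refine ⟨max 1 (C / ε), fun t ht x hx => ?_⟩
  have ht0 : t < 0 := lt_of_le_of_lt ht.2 (by norm_num)
  have hx1 : 1 ≤ ‖x‖ := (le_max_left _ _).trans hx
  have hxC : C / ε ≤ ‖x‖ := (le_max_right _ _).trans hx
  have hsq : 0 ≤ Real.sqrt (-t) := Real.sqrt_nonneg _
  have hDpos : 0 < ‖x‖ + Real.sqrt (-t) := by linarith
  refine (hI t ht0 x).trans ?_
  by_cases hC : 0 ≤ C
  · calc C / (‖x‖ + Real.sqrt (-t)) ≤ C / ‖x‖ := by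
          exact div_le_div_of_nonneg_left hC (by linarith) (by linarith)
      _ ≤ ε := by
          rw [div_le_iff₀ (by linarith)]
          have := (div_le_iff₀ hε).mp hxC
          linarith
  · push Not at hC
    exact (div_neg_of_neg_of_pos hC hDpos).le.trans hε.le

/-! ## §2 Attainment of the velocity number on the DSS class -/

/-- ★★ **ATTAINMENT OF THE VELOCITY NUMBER ON THE DSS CLASS.**  `u` jointly smooth on `t < 0`, `c`-DSS with
`c > 1`, `u → 0` at spatial infinity uniformly on the period `[−c², −1]`, `u ≢ 0` on `t < 0`.  Then the squared
velocity number `(0 − s)|u(s,y)|²` attains its supremum over ALL of `(−∞,0) × ℝ³` at some `(t,x)` with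
`u(t,x) ≠ 0`. [folklore] -/
theorem dss_velocityNumber_attained {c : ℝ} (hc : 1 < c)
    {u : ℝ → (EuclideanSpace ℝ (Fin 3)) → (EuclideanSpace ℝ (Fin 3))}
    (hsm : IsSmoothSpaceTimeOn (Iio 0) u) (hdss : IsDiscretelySelfSimilar c u)
    (hdecay : ∀ ε : ℝ, 0 < ε → ∃ R : ℝ, ∀ t ∈ Icc (-(c ^ 2)) (-1), ∀ x : EuclideanSpace ℝ (Fin 3),
      R ≤ ‖x‖ → ‖u t x‖ ≤ ε)
    (hne : ∃ t₀ : ℝ, t₀ < 0 ∧ ∃ x₀ : EuclideanSpace ℝ (Fin 3), u t₀ x₀ ≠ 0) :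
    ∃ t : ℝ, t < 0 ∧ ∃ x : EuclideanSpace ℝ (Fin 3), u t x ≠ 0 ∧
      ∀ s : ℝ, s < 0 → ∀ y : EuclideanSpace ℝ (Fin 3),
        (0 - s) * ‖u s y‖ ^ 2 ≤ (0 - t) * ‖u t x‖ ^ 2 := by
  have hc0 : 0 < c := one_pos.trans hc
  have hc2 : 0 < c ^ 2 := pow_pos hc0 2
  obtain ⟨t₀, ht₀, x₀, hu₀⟩ := hne
  obtain ⟨V₀, hV₀⟩ : ∃ V₀ : ℝ, V₀ = (0 - t₀) * ‖u t₀ x₀‖ ^ 2 := ⟨_, rfl⟩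
  have hV₀pos : 0 < V₀ := by rw [hV₀]; exact mul_pos (by linarith) (pow_pos (norm_pos_iff.mpr hu₀) 2)
  obtain ⟨R, hR⟩ := hdecay (min 1 (V₀ / (2 * c ^ 2))) (lt_min one_pos (by positivity))
  -- far field: `(0 − s)|u|² ≤ c²·ε ≤ V₀/2`
  have hout : ∀ s ∈ Icc (-(c ^ 2)) (-1), ∀ (y : EuclideanSpace ℝ (Fin 3)), R ≤ ‖y‖ →
      (0 - s) * ‖u s y‖ ^ 2 ≤ V₀ / 2 := by
    intro s hs y hy
    have h1 := hR s hs y hy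
    have h1a : ‖u s y‖ ≤ 1 := h1.trans (min_le_left _ _)
    have h1b : ‖u s y‖ ≤ V₀ / (2 * c ^ 2) := h1.trans (min_le_right _ _)
    have hsq : ‖u s y‖ ^ 2 ≤ V₀ / (2 * c ^ 2) := by nlinarith [norm_nonneg (u s y)]
    have hs0 : 0 ≤ 0 - s := by linarith [hs.2]
    have hs2 : 0 - s ≤ c ^ 2 := by linarith [hs.1]
    calc (0 - s) * ‖u s y‖ ^ 2 ≤ c ^ 2 * (V₀ / (2 * c ^ 2)) := by
          exact mul_le_mul hs2 hsq (sq_nonneg _) hc2.le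
      _ = V₀ / 2 := by field_simp
  -- period representatives
  have hrep : ∀ s : ℝ, s < 0 → ∀ (y : EuclideanSpace ℝ (Fin 3)),
      ∃ s' ∈ Icc (-(c ^ 2)) (-1), ∃ y' : EuclideanSpace ℝ (Fin 3),
        (0 - s) * ‖u s y‖ ^ 2 = (0 - s') * ‖u s' y'‖ ^ 2 := by
    intro s hs y
    obtain ⟨n, hn1, hn2⟩ := exists_dss_period_rep hc hs
    exact ⟨(c ^ n) ^ 2 * s, ⟨hn1.le, hn2⟩, (c ^ n) • y, dss_velocityNumber_zpow hc0.ne' hdss n s y⟩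
  -- compact period cylinder
  obtain ⟨K, hK⟩ : ∃ K : Set (ℝ × EuclideanSpace ℝ (Fin 3)),
      K = Icc (-(c ^ 2)) (-1) ×ˢ closedBall (0 : EuclideanSpace ℝ (Fin 3)) R := ⟨_, rfl⟩
  have hKc : IsCompact K := by rw [hK]; exact isCompact_Icc.prod (isCompact_closedBall _ _)
  have hmemK : ∀ {s : ℝ} {y : EuclideanSpace ℝ (Fin 3)}, s ∈ Icc (-(c ^ 2)) (-1) → ‖y‖ ≤ R →
      (s, y) ∈ K := by
    intro s y hs hy
    rw [hK]; exact mk_mem_prod hs (mem_closedBall_zero_iff.mpr hy)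
  have hKsub : ∀ {z : ℝ × EuclideanSpace ℝ (Fin 3)}, z ∈ K → z.1 ∈ Icc (-(c ^ 2)) (-1) ∧ ‖z.2‖ ≤ R := by
    intro z hz
    rw [hK] at hz
    exact ⟨(mem_prod.mp hz).1, mem_closedBall_zero_iff.mp (mem_prod.mp hz).2⟩
  have hψc : ContinuousOn (fun z : ℝ × EuclideanSpace ℝ (Fin 3) => (0 - z.1) * ‖u z.1 z.2‖ ^ 2) K := by
    have hUc : ContinuousOn (fun z : ℝ × EuclideanSpace ℝ (Fin 3) => u z.1 z.2) K := by
      refine hsm.continuousOn.mono fun z hz => mk_mem_prod ?_ (mem_univ _)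
      exact lt_of_le_of_lt (hKsub hz).1.2 (by norm_num)
    exact (by fun_prop : Continuous fun z : ℝ × EuclideanSpace ℝ (Fin 3) => (0 : ℝ) - z.1).continuousOn.mul
      (hUc.norm.pow 2)
  obtain ⟨s₀, hs₀, y₀, hV₀eq⟩ := hrep t₀ ht₀ x₀
  have hy₀ : ‖y₀‖ ≤ R := by
    by_contra hcon
    push Not at hcon
    have := hout s₀ hs₀ y₀ hcon.le
    rw [← hV₀eq, ← hV₀] at this
    linarith
  have h0K : (s₀, y₀) ∈ K := hmemK hs₀ hy₀
  obtain ⟨z, hzK, hmax⟩ := hKc.exists_isMaxOn ⟨(s₀, y₀), h0K⟩ hψc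
  obtain ⟨htI, -⟩ := hKsub hzK
  have ht : z.1 < 0 := lt_of_le_of_lt htI.2 (by norm_num)
  have hV₀le : V₀ ≤ (0 - z.1) * ‖u z.1 z.2‖ ^ 2 := by
    have := isMaxOn_iff.mp hmax (s₀, y₀) h0K
    rw [hV₀, hV₀eq]; exact this
  refine ⟨z.1, ht, z.2, ?_, ?_⟩
  · intro hzero
    rw [hzero, norm_zero] at hV₀le
    norm_num at hV₀le
    linarith
  · intro s hs y
    obtain ⟨s', hs', y', hEq⟩ := hrep s hs y
    rw [hEq]
    by_cases hy : ‖y'‖ ≤ R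
    · exact isMaxOn_iff.mp hmax (s', y') (hmemK hs' hy)
    · push Not at hy
      exact ((hout s' hs' y' hy.le).trans (by linarith)).trans hV₀le

/-! ## §3 The velocity record law on the DSS class -/

/-- ★★ **THE VELOCITY RECORD LAW OF A DSS SINGULARITY.**  Classical unforced solution on `t < 0` (`ν ≥ 0`),
`c`-DSS (`c > 1`), `u → 0` at spatial infinity uniformly on the period, `u ≢ 0`.  Then at some `(t,x)`, `t < 0`,
`u(t,x) ≠ 0`, maximising the velocity number over all of `(−∞,0) × ℝ³`:
`|u|·(1 + 2ν(0 − t)|∇û|²_F) ≤ 2(0 − t)·(−⟪û, ∇p⟫)`. [folklore] -/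
theorem dss_velocity_record_law {ν c : ℝ}
    {u : ℝ → (EuclideanSpace ℝ (Fin 3)) → (EuclideanSpace ℝ (Fin 3))} {p : ℝ → (EuclideanSpace ℝ (Fin 3)) → ℝ}
    (hν : 0 ≤ ν) (hsol : IsClassicalNSSolutionOn (Iio 0) ν 0 u p) (hc : 1 < c)
    (hdss : IsDiscretelySelfSimilar c u)
    (hdecay : ∀ ε : ℝ, 0 < ε → ∃ R : ℝ, ∀ t ∈ Icc (-(c ^ 2)) (-1), ∀ x : EuclideanSpace ℝ (Fin 3),
      R ≤ ‖x‖ → ‖u t x‖ ≤ ε)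
    (hne : ∃ t₀ : ℝ, t₀ < 0 ∧ ∃ x₀ : EuclideanSpace ℝ (Fin 3), u t₀ x₀ ≠ 0) :
    ∃ t : ℝ, t < 0 ∧ ∃ x : EuclideanSpace ℝ (Fin 3), u t x ≠ 0 ∧
      (∀ s : ℝ, s < 0 → ∀ y : EuclideanSpace ℝ (Fin 3), (0 - s) * ‖u s y‖ ^ 2 ≤ (0 - t) * ‖u t x‖ ^ 2) ∧
      ‖u t x‖ * (1 + 2 * ν * (0 - t) * frobeniusNormSq (fderiv ℝ (vorticityDirection (u t)) x)) ≤
        2 * (0 - t) * (-⟪vorticityDirection (u t) x, gradient (p t) x⟫) := by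
  obtain ⟨t, ht, x, hux, hmax⟩ := dss_velocityNumber_attained hc hsol.smooth_velocity hdss hdecay hne
  refine ⟨t, ht, x, hux, hmax, ?_⟩
  have hS : (Iio (0 : ℝ)) ∈ 𝓝 t := Iio_mem_nhds ht
  have hmaxX : ∀ y, ‖u t y‖ ≤ ‖u t x‖ := fun y => by
    have h2 : ‖u t y‖ ^ 2 ≤ ‖u t x‖ ^ 2 := le_of_mul_le_mul_left (hmax t ht y) (by linarith)
    exact (pow_le_pow_iff_left₀ (norm_nonneg _) (norm_nonneg _) two_ne_zero).mp h2
  have hmaxT : IsLocalMaxOn (fun s => (0 - s) * ‖u s x‖ ^ 2) (Iic t) t := by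
    have hev : ∀ᶠ s in 𝓝[Iic t] t, s < 0 :=
      mem_nhdsWithin_of_mem_nhds (Iio_mem_nhds ht)
    show ∀ᶠ s in 𝓝[Iic t] t, (0 - s) * ‖u s x‖ ^ 2 ≤ (0 - t) * ‖u t x‖ ^ 2
    filter_upwards [hev] with s hs using hmax s hs x
  exact velocity_record_law_dir hν (uniqueDiffOn_Iio 0) hsol hS ht hmaxX hmaxT hux

/-- ★★ **`V* ≤ 2Π*`: the speed is at most twice the pressure-gradient number at the velocity record.**  Under the
hypotheses of `dss_velocity_record_law`: at the maximiser, `|u(t,x)| ≤ 2(0 − t)·|∇p(t,x)|`, i.e.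
`(−t)^{1/2}|u| ≤ 2·(−t)^{3/2}|∇p|` in scale-invariant numbers. [folklore] -/
theorem dss_velocity_le_pressureGradient {ν c : ℝ}
    {u : ℝ → (EuclideanSpace ℝ (Fin 3)) → (EuclideanSpace ℝ (Fin 3))} {p : ℝ → (EuclideanSpace ℝ (Fin 3)) → ℝ}
    (hν : 0 ≤ ν) (hsol : IsClassicalNSSolutionOn (Iio 0) ν 0 u p) (hc : 1 < c)
    (hdss : IsDiscretelySelfSimilar c u)
    (hdecay : ∀ ε : ℝ, 0 < ε → ∃ R : ℝ, ∀ t ∈ Icc (-(c ^ 2)) (-1), ∀ x : EuclideanSpace ℝ (Fin 3),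
      R ≤ ‖x‖ → ‖u t x‖ ≤ ε)
    (hne : ∃ t₀ : ℝ, t₀ < 0 ∧ ∃ x₀ : EuclideanSpace ℝ (Fin 3), u t₀ x₀ ≠ 0) :
    ∃ t : ℝ, t < 0 ∧ ∃ x : EuclideanSpace ℝ (Fin 3), u t x ≠ 0 ∧
      (∀ s : ℝ, s < 0 → ∀ y : EuclideanSpace ℝ (Fin 3), (0 - s) * ‖u s y‖ ^ 2 ≤ (0 - t) * ‖u t x‖ ^ 2) ∧
      ‖u t x‖ ≤ 2 * (0 - t) * ‖gradient (p t) x‖ := by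
  obtain ⟨t, ht, x, hux, hmax, hlaw⟩ := dss_velocity_record_law hν hsol hc hdss hdecay hne
  refine ⟨t, ht, x, hux, hmax, ?_⟩
  have hF : 0 ≤ frobeniusNormSq (fderiv ℝ (vorticityDirection (u t)) x) := frobeniusNormSq_nonneg _
  have ht0 : 0 ≤ 0 - t := by linarith
  have hdir1 : ‖vorticityDirection (u t) x‖ = 1 := norm_vorticityDirection _ hux
  have hcs : -⟪vorticityDirection (u t) x, gradient (p t) x⟫ ≤ ‖gradient (p t) x‖ := by
    have h := abs_real_inner_le_norm (vorticityDirection (u t) x) (gradient (p t) x)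
    rw [hdir1, one_mul] at h
    linarith [neg_abs_le ⟪vorticityDirection (u t) x, gradient (p t) x⟫]
  have h1 : ‖u t x‖ ≤ ‖u t x‖ * (1 + 2 * ν * (0 - t) * frobeniusNormSq (fderiv ℝ (vorticityDirection (u t)) x)) := by
    have : 0 ≤ 2 * ν * (0 - t) * frobeniusNormSq (fderiv ℝ (vorticityDirection (u t)) x) := by positivity
    nlinarith [norm_nonneg (u t x)]
  calc ‖u t x‖ ≤ 2 * (0 - t) * (-⟪vorticityDirection (u t) x, gradient (p t) x⟫) := h1.trans hlaw
    _ ≤ 2 * (0 - t) * ‖gradient (p t) x‖ := mul_le_mul_of_nonneg_left hcs (by positivity)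

/-! ## §4 On Chae–Wolf's class: the first record law with no extra hypothesis -/

/-- ★★ **THE VELOCITY RECORD LAW ON CHAE–WOLF'S CLASS.**  Assume the Literature fact
`chaeWolf2017_dss_typeI_decay` (Chae–Wolf 2017, Thm 1.1: DSS solutions with slices continuous into `L^q`, `q ≥ 3`,
obey a Type-I bound).  Then every `c`-DSS classical solution `(u,p)` of the unforced Navier–Stokes equations
(`ν = 1`) on `t < 0` with `u t ∈ L^q`, `t ↦ u t` continuous into `L^q` on `(−∞,0)`, and `u ≢ 0`, has a point
`(t,x)`, `t < 0`, `u(t,x) ≠ 0`, maximising the velocity number over `(−∞,0) × ℝ³`, at which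
`|u|·(1 + 2(0 − t)|∇û|²_F) ≤ 2(0 − t)·(−⟪û, ∇p⟫)` and `|u| ≤ 2(0 − t)|∇p|`. [cite: ChaeWolf2017RemovingDSS, Theorem 1.1 (arXiv:1610.09464 p. 3)] -/
theorem chaeWolf_dss_velocity_record_law (hCW : chaeWolf2017_dss_typeI_decay) {q : ℝ} (hq : 3 ≤ q)
    {c : ℝ} (hc : 1 < c)
    {u : ℝ → (EuclideanSpace ℝ (Fin 3)) → (EuclideanSpace ℝ (Fin 3))} {p : ℝ → (EuclideanSpace ℝ (Fin 3)) → ℝ}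
    (hsol : IsClassicalNSSolutionOn (Iio 0) 1 0 u p)
    (hLq : ∀ t < 0, MemLp (u t) (ENNReal.ofReal q) volume)
    (hcont : ∀ t₀ < 0, Filter.Tendsto (fun t => eLpNorm (u t - u t₀) (ENNReal.ofReal q) volume)
      (nhdsWithin t₀ (Iio 0)) (nhds 0))
    (hdss : IsDiscretelySelfSimilar c u)
    (hne : ∃ t₀ : ℝ, t₀ < 0 ∧ ∃ x₀ : EuclideanSpace ℝ (Fin 3), u t₀ x₀ ≠ 0) :
    ∃ t : ℝ, t < 0 ∧ ∃ x : EuclideanSpace ℝ (Fin 3), u t x ≠ 0 ∧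
      (∀ s : ℝ, s < 0 → ∀ y : EuclideanSpace ℝ (Fin 3), (0 - s) * ‖u s y‖ ^ 2 ≤ (0 - t) * ‖u t x‖ ^ 2) ∧
      ‖u t x‖ * (1 + 2 * 1 * (0 - t) * frobeniusNormSq (fderiv ℝ (vorticityDirection (u t)) x)) ≤
        2 * (0 - t) * (-⟪vorticityDirection (u t) x, gradient (p t) x⟫) ∧
      ‖u t x‖ ≤ 2 * (0 - t) * ‖gradient (p t) x‖ := by
  obtain ⟨C, hI⟩ := hCW q hq c hc u p hsol hLq hcont hdss
  have hdecay := periodVelocityDecay_of_typeI (c := c) hI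
  obtain ⟨t, ht, x, hux, hmax, hlaw⟩ :=
    dss_velocity_record_law zero_le_one hsol hc hdss hdecay hne
  refine ⟨t, ht, x, hux, hmax, hlaw, ?_⟩
  have hdir1 : ‖vorticityDirection (u t) x‖ = 1 := norm_vorticityDirection _ hux
  have hcs : -⟪vorticityDirection (u t) x, gradient (p t) x⟫ ≤ ‖gradient (p t) x‖ := by
    have h := abs_real_inner_le_norm (vorticityDirection (u t) x) (gradient (p t) x)
    rw [hdir1, one_mul] at h
    linarith [neg_abs_le ⟪vorticityDirection (u t) x, gradient (p t) x⟫]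
  have h1 : ‖u t x‖ ≤ ‖u t x‖ * (1 + 2 * 1 * (0 - t) * frobeniusNormSq (fderiv ℝ (vorticityDirection (u t)) x)) := by
    have : 0 ≤ 2 * 1 * (0 - t) * frobeniusNormSq (fderiv ℝ (vorticityDirection (u t)) x) := by
      have hF : 0 ≤ frobeniusNormSq (fderiv ℝ (vorticityDirection (u t)) x) := frobeniusNormSq_nonneg _
      have ht0 : 0 ≤ 0 - t := by linarith
      positivity
    nlinarith [norm_nonneg (u t x)]
  have ht0 : 0 ≤ 0 - t := by linarith
  calc ‖u t x‖ ≤ 2 * (0 - t) * (-⟪vorticityDirection (u t) x, gradient (p t) x⟫) := h1.trans hlaw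
    _ ≤ 2 * (0 - t) * ‖gradient (p t) x‖ := mul_le_mul_of_nonneg_left hcs (by positivity)

end Summit.NavierStokesRegularity.NavierStokesRegularity.Theorems.StrainDoors

end
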